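import Summits.QuantumFields.YangMills.Theorems.ForcedResponseSkewnessResponseLocalisationFarStub
import HarnessLib

/-!
# Crux `ResponseLocalisation` (repaired item stmt-QuantumFields-24293), route `ForcedResponseSkewness`:
# the re-cut far-field stub from a majorant on SEPARATED triples only

Support file (`--supports stmt-QuantumFields-24293`) of the width prover `ym-line-frs-p2` (lead `ym-line-frs-p1`); sequel of
`…ResponseLocalisationFarStub` (`stub_far_of_farKernel`).  The far-field sum charges only triples `(x, y, z)` with `x` far
(`‖s x‖ > D`) and `y, z` in the two source balls, whose three pairwise torus distances all exceed `1/s` resp. `2g/s`; so the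
triangle majorant on the third cumulant is needed only for triples with pairwise torus distance `≥ n₀`, for ANY fixed `n₀`
— the lattice-scale / contact (OPE) regime of the third cumulant is never invoked.  This weakens the physics input of the far
stub to a `KernelBounds`-style statement with a threshold `n₀` (cf. `RunningCouplingCeiling.Pointwise.KernelBounds`):

* `far_sum_abs_smear_le_of_sep` — abstract kernel, majorant on separated triples, spacings `s·n₀ ≤ min 1 (2g)` (the kernel
  cut off to separated triples obeys the majorant everywhere and agrees with `K` on every charged far triple);
* `far_ceiling_of_gap_sep` — per-source ε-form;
* `stub_far_of_farKernelSep` — **the planner's re-cut `__Registered.stub_far` text (verbatim) from the SEPARATED FAR KERNEL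
  HYPOTHESIS** «pinned unit ⇒ `∃ A β₀ Λ₀ n₀, ∀ β ≥ β₀, ∀ L, Λ₀ ≤ aβ·L →` triangle majorant for `torusK3_{β,L}` on triples of
  `box L` with pairwise torus distance `≥ n₀`» (E0′-type third-cumulant ceiling with pairwise hyperscaling decay at separated
  points, uniform on tori larger than the unit; engine-grade, NOT proved here).

Honest label: reduces ONE stub of a CONDITIONAL rung line (leaf R2a `BalabanLadder.NT`) to a named physics input; the crux, NT and
the route stay open; nothing here bears on the Yang–Mills mass gap, which is NOT proved by any of this.
-/

set_option autoImplicit false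

noncomputable section

namespace Summit.QuantumFields.YangMills.Cruxes.ResponseLocalisation.Far

open Set Metric Filter Topology Finset MeasureTheory
open scoped SchwartzMap
open Literature.MathematicalPhysics.QuantumLattice Literature.Probability.LatticeModels
open Literature.MathematicalPhysics.QuantumFieldTheory
open Summit.QuantumFields.YangMills.Cruxes.RunningCouplingCeiling.Pointwise
open Summit.QuantumFields.YangMills.Cruxes.OSLegsFromFemtoAndGap.DlrCollarTransfer
open Summit.QuantumFields.YangMills.Cruxes.ResponseLocalisation.Birth

/-! ### The far kernel hypothesis is needed only on SEPARATED triples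

The far-field sum charges only triples `(x, y, z)` with `x` far (`‖s x‖ > D`) and `y, z` in the two source balls, whose
three pairwise torus distances all exceed `1/s` resp. `2g/s`; so the majorant is needed only for triples with pairwise
torus distance `≥ n₀`, ANY fixed `n₀` (the lattice-scale / OPE regime of the third cumulant is never invoked).  This weakens
the physics input to a KernelBounds-style statement with a threshold `n₀` (cf. `RunningCouplingCeiling.Pointwise.KernelBounds`). -/

section Separated

/-- **Far-field smearing with the majorant on separated triples only.**  As `far_sum_abs_smear_le`, but the triangle
majorant is assumed only for triples with pairwise torus distances `≥ n₀`, at spacings `s·n₀ ≤ min 1 (2g)` (then every charged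
far triple is separated; apply `far_sum_abs_smear_le` to the kernel cut off to separated triples). -/
theorem far_sum_abs_smear_le_of_sep (L : ℕ) {s : ℝ} (hs : 0 < s) (hs1 : s ≤ 1)
    (φ ψ : EuclideanSpace ℝ (Fin 4) → ℝ) {R₀ g : ℝ} (hg : 0 < g)
    (hφR : ∀ w, φ w ≠ 0 → ‖w‖ ≤ R₀) (hψR : ∀ w, ψ w ≠ 0 → ‖w‖ ≤ R₀)
    (hφt : ∀ w, φ w ≠ 0 → w 0 ≤ -g) (hψt : ∀ w, ψ w ≠ 0 → g ≤ w 0)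
    (hL : 2 * R₀ ≤ s * L)
    (K : Site 4 → Site 4 → Site 4 → ℝ) {A : ℝ} (hA : 0 ≤ A) (n₀ : ℕ) (hn1 : s * n₀ ≤ 1)
    (hn2 : s * n₀ ≤ 2 * g)
    (hK : ∀ x ∈ box 4 L, ∀ y ∈ box 4 L, ∀ z ∈ box 4 L,
      (n₀ : ℝ) ≤ torusDist L x y → (n₀ : ℝ) ≤ torusDist L x z → (n₀ : ℝ) ≤ torusDist L y z →
      |K x y z| ≤ A * (((1 + torusDist L x y) ^ 4)⁻¹ * ((1 + torusDist L x z) ^ 4)⁻¹ *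
        ((1 + torusDist L y z) ^ 4)⁻¹))
    {D : ℝ} (hD2 : 2 ≤ D) (hDR : 2 * R₀ + 1 ≤ D) :
    ∑ x ∈ (box 4 L).filter (fun x : Site 4 => D < ‖s • siteToE x‖),
        |∑ y ∈ box 4 L, ∑ z ∈ box 4 L, φ (s • siteToE y) * ψ (s • siteToE z) * K x y z|
      ≤ 2 ^ 14 * A / (g ^ 4 * D) * (s ^ 4 * ∑ y ∈ box 4 L, |φ (s • siteToE y)|) *
          (s ^ 4 * ∑ z ∈ box 4 L, |ψ (s • siteToE z)|) := by
  classical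
  -- the kernel cut off to separated triples obeys the majorant everywhere
  set K' : Site 4 → Site 4 → Site 4 → ℝ := fun x y z =>
    if (n₀ : ℝ) ≤ torusDist L x y ∧ (n₀ : ℝ) ≤ torusDist L x z ∧ (n₀ : ℝ) ≤ torusDist L y z then K x y z else 0
    with hK'
  have hK'b : ∀ x ∈ box 4 L, ∀ y ∈ box 4 L, ∀ z ∈ box 4 L,
      |K' x y z| ≤ A * (((1 + torusDist L x y) ^ 4)⁻¹ * ((1 + torusDist L x z) ^ 4)⁻¹ *
        ((1 + torusDist L y z) ^ 4)⁻¹) := by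
    intro x hx y hy z hz
    simp only [hK']
    split_ifs with h
    · exact hK x hx y hy z hz h.1 h.2.1 h.2.2
    · rw [abs_zero]
      have := torusDist_nonneg L x y
      have := torusDist_nonneg L x z
      have := torusDist_nonneg L y z
      positivity
  have hmain := far_sum_abs_smear_le L hs hs1 φ ψ hg hφR hψR hφt hψt hL K' hA hK'b hD2 hDR
  -- coordinates of scaled sites
  have e0 : ∀ x : Site 4, (s • siteToE x) 0 = s * (x 0 : ℝ) := fun x => by simp
  have n0 : ∀ u : EuclideanSpace ℝ (Fin 4), |u 0| ≤ ‖u‖ := fun u => by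
    have h := PiLp.norm_apply_le u 0
    rwa [Real.norm_eq_abs] at h
  -- every charged far triple is separated, so `K` and `K'` agree on it
  have heq : ∀ x ∈ (box 4 L).filter (fun x : Site 4 => D < ‖s • siteToE x‖),
      ∑ y ∈ box 4 L, ∑ z ∈ box 4 L, φ (s • siteToE y) * ψ (s • siteToE z) * K x y z =
        ∑ y ∈ box 4 L, ∑ z ∈ box 4 L, φ (s • siteToE y) * ψ (s • siteToE z) * K' x y z := by
    intro x hx
    rw [Finset.mem_filter] at hx
    refine Finset.sum_congr rfl fun y _ => Finset.sum_congr rfl fun z _ => ?_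
    by_cases hφ : φ (s • siteToE y) = 0
    · rw [hφ]; simp
    by_cases hψ : ψ (s • siteToE z) = 0
    · rw [hψ]; simp
    -- geometry of the charged far triple
    have hyR : ‖s • siteToE y‖ ≤ R₀ := hφR _ hφ
    have hzR : ‖s • siteToE z‖ ≤ R₀ := hψR _ hψ
    have hR0 : 0 ≤ R₀ := le_trans (norm_nonneg _) hyR
    have hsx : ‖s • siteToE x‖ = s * ‖siteToE x‖ := norm_smul_siteToE hs.le x
    have hsy : ‖s • siteToE y‖ = s * ‖siteToE y‖ := norm_smul_siteToE hs.le y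
    have hsz : ‖s • siteToE z‖ = s * ‖siteToE z‖ := norm_smul_siteToE hs.le z
    -- x legs: `s · d_T(x, ·) ≥ ‖s x‖ − R₀ > D − R₀ ≥ 1 ≥ s n₀`
    have hleg : ∀ w : Site 4, ‖s • siteToE w‖ ≤ R₀ → ‖s • siteToE w‖ = s * ‖siteToE w‖ →
        (n₀ : ℝ) ≤ torusDist L x w := by
      intro w hwR hsw
      have hgeo := norm_sub_norm_le_torusDist L w hx.1
      have h1 : s * (‖siteToE x‖ - ‖siteToE w‖) ≤ s * torusDist L x w :=
        mul_le_mul_of_nonneg_left hgeo hs.le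
      have h2 : s * (n₀ : ℝ) ≤ s * torusDist L x w := by
        rw [mul_sub] at h1
        rw [hsx] at hx
        rw [hsw] at hwR
        linarith [hx.2]
      exact le_of_mul_le_mul_left h2 hs
    have hxy := hleg y hyR hsy
    have hxz := hleg z hzR hsz
    -- y–z leg: time separation without wrap-around
    have ht1 : s * (y 0 : ℝ) ≤ -g := by rw [← e0]; exact hφt _ hφ
    have ht2 : g ≤ s * (z 0 : ℝ) := by rw [← e0]; exact hψt _ hψ
    have hny : |s * (y 0 : ℝ)| ≤ R₀ := by rw [← e0]; exact (n0 _).trans hyR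
    have hnz : |s * (z 0 : ℝ)| ≤ R₀ := by rw [← e0]; exact (n0 _).trans hzR
    have hgap : 2 * g ≤ s * |((y 0 : ℝ)) - (z 0 : ℝ)| := by
      have : s * |((y 0 : ℝ)) - (z 0 : ℝ)| ≥ s * ((z 0 : ℝ) - y 0) := by
        rw [ge_iff_le]; refine mul_le_mul_of_nonneg_left ?_ hs.le
        rw [abs_sub_comm]; exact le_abs_self _
      nlinarith
    have hnowrapR : s * |((y 0 : ℝ)) - (z 0 : ℝ)| ≤ s * L := by
      have h1 : s * |((y 0 : ℝ)) - (z 0 : ℝ)| = |s * (y 0 : ℝ) - s * (z 0 : ℝ)| := by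
        rw [← mul_sub, abs_mul, abs_of_pos hs]
      rw [h1]
      calc |s * (y 0 : ℝ) - s * (z 0 : ℝ)| ≤ |s * (y 0 : ℝ)| + |s * (z 0 : ℝ)| := abs_sub _ _
        _ ≤ R₀ + R₀ := add_le_add hny hnz
        _ = 2 * R₀ := by ring
        _ ≤ s * L := hL
    have hnowrap : |y 0 - z 0| ≤ (L : ℤ) := by
      have h1 : |((y 0 : ℝ)) - (z 0 : ℝ)| ≤ L := le_of_mul_le_mul_left hnowrapR hs
      have h2 : (((|y 0 - z 0| : ℤ)) : ℝ) ≤ ((L : ℤ) : ℝ) := by push_cast; exact h1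
      exact_mod_cast h2
    have hd := abs_sub_le_torusDist L y z hnowrap
    have hyz : (n₀ : ℝ) ≤ torusDist L y z := by
      have h2 : s * (n₀ : ℝ) ≤ s * torusDist L y z := by nlinarith
      exact le_of_mul_le_mul_left h2 hs
    simp only [hK', if_pos (And.intro hxy (And.intro hxz hyz))]
  rw [Finset.sum_congr rfl fun x hx => by rw [heq x hx]]
  exact hmain

variable (G : Type) [Group G] [TopologicalSpace G] [IsTopologicalGroup G] [CompactSpace G]
  [MeasurableSpace G] [BorelSpace G] (r : LatticeRep G)

/-- **Far-field ceiling, per source, from the majorant on separated triples.**  As `far_ceiling_of_gap`, with the triangle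
majorant assumed only for triples of pairwise torus distance `≥ n₀` (the spacing threshold `s₀` then also enforces
`s₀·n₀ ≤ min 1 (2g)`). -/
theorem far_ceiling_of_gap_sep (v : 𝓢(EuclideanSpace ℝ (Fin 4), ℝ)) {p : EuclideanSpace ℝ (Fin 4)} {ρ : ℝ}
    (hball : tsupport (v : EuclideanSpace ℝ (Fin 4) → ℝ) ⊆ Metric.closedBall p ρ)
    (hsupp : tsupport (v : EuclideanSpace ℝ (Fin 4) → ℝ) ⊆ {y : EuclideanSpace ℝ (Fin 4) | 0 < y 0})
    {A : ℝ} (hA : 0 ≤ A) (n₀ : ℕ) {η : ℝ} (hη : 0 < η) :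
    ∃ D : ℝ, 0 < D ∧ ∃ s₀ : ℝ, 0 < s₀ ∧ ∀ s : ℝ, 0 < s → s ≤ s₀ → ∀ L : ℕ, 2 * (‖p‖ + ρ) ≤ s * L →
      ∀ β : ℝ,
        (∀ x ∈ box 4 L, ∀ y ∈ box 4 L, ∀ z ∈ box 4 L,
          (n₀ : ℝ) ≤ torusDist L x y → (n₀ : ℝ) ≤ torusDist L x z → (n₀ : ℝ) ≤ torusDist L y z →
          |torusK3 G r β L x y z| ≤
            A * (((1 + torusDist L x y) ^ 4)⁻¹ * ((1 + torusDist L x z) ^ 4)⁻¹ *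
              ((1 + torusDist L y z) ^ 4)⁻¹)) →
        ∑ x ∈ box 4 L, (if D < ‖s • siteToE x‖ then |respM G r β L s v x| else 0) ≤ η := by
  obtain ⟨g, hg, hv', hθ'⟩ := exists_wall_gap v hball hsupp
  set R₀ : ℝ := ‖p‖ + ρ with hR₀
  set N : ℝ := (∫ y, |v y|) + 1 with hN
  have hN0 : 0 < N := by
    have : 0 ≤ ∫ y, |v y| := integral_nonneg fun _ => abs_nonneg _
    rw [hN]; linarith
  set D : ℝ := max (max 2 (2 * R₀ + 1)) (2 ^ 14 * A * N ^ 2 / (g ^ 4 * η) + 1) with hD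
  have hD2 : 2 ≤ D := le_trans (le_max_left _ _) (le_max_left _ _)
  have hDR : 2 * R₀ + 1 ≤ D := le_trans (le_max_right _ _) (le_max_left _ _)
  have hDA : 2 ^ 14 * A * N ^ 2 / (g ^ 4 * η) < D := lt_of_lt_of_le (lt_add_one _) (le_max_right _ _)
  have hD0 : 0 < D := by linarith
  have hvR : tsupport (v : EuclideanSpace ℝ (Fin 4) → ℝ) ⊆ Metric.closedBall 0 R₀ := by
    refine hball.trans (Metric.closedBall_subset_closedBall' ?_)
    rw [hR₀, dist_zero_right]; linarith
  have hθR := Summit.QuantumFields.YangMills.Cruxes.NT.Reference.tsupport_thetaTest_subset_closedBall_zero hvR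
  obtain ⟨s₁, hs₁, h₁⟩ := exists_latticeSum_abs_le v hvR
  obtain ⟨s₂, hs₂, h₂⟩ := exists_latticeSum_abs_le (thetaTest 4 v) hθR
  -- spacing threshold: Riemann sums, `s ≤ 1`, and separation `s (n₀+1) ≤ min 1 (2g)`
  set s₃ : ℝ := min 1 (2 * g) / ((n₀ : ℝ) + 1) with hs₃
  have hs₃0 : 0 < s₃ := by rw [hs₃]; exact div_pos (lt_min one_pos (by linarith)) (by positivity)
  refine ⟨D, hD0, min (min s₁ s₂) (min 1 s₃), by positivity, fun s hs hss₀ L hL β hK => ?_⟩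
  have hs1 : s ≤ 1 := le_trans hss₀ (le_trans (min_le_right _ _) (min_le_left _ _))
  have hss₁ : s ≤ s₁ := le_trans hss₀ (le_trans (min_le_left _ _) (min_le_left _ _))
  have hss₂ : s ≤ s₂ := le_trans hss₀ (le_trans (min_le_left _ _) (min_le_right _ _))
  have hss₃ : s ≤ s₃ := le_trans hss₀ (le_trans (min_le_right _ _) (min_le_right _ _))
  have hsn : s * n₀ ≤ min 1 (2 * g) := by
    have h1 : s * ((n₀ : ℝ) + 1) ≤ s₃ * ((n₀ : ℝ) + 1) := mul_le_mul_of_nonneg_right hss₃ (by positivity)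
    have h2 : s₃ * ((n₀ : ℝ) + 1) = min 1 (2 * g) := by rw [hs₃]; field_simp
    have h3 : s * (n₀ : ℝ) ≤ s * ((n₀ : ℝ) + 1) := by nlinarith
    linarith
  have hn1 : s * n₀ ≤ 1 := hsn.trans (min_le_left _ _)
  have hn2 : s * n₀ ≤ 2 * g := hsn.trans (min_le_right _ _)
  have hRL : R₀ ≤ s * L := by
    have : 0 ≤ s * L := by positivity
    by_cases hR : 0 ≤ R₀ <;> linarith
  have hSv : s ^ 4 * ∑ z ∈ box 4 L, |v (s • siteToE z)| ≤ N := h₁ s hs hss₁ L hRL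
  have hSθ : s ^ 4 * ∑ y ∈ box 4 L, |(thetaTest 4 v) (s • siteToE y)| ≤ N := by
    have := h₂ s hs hss₂ L hRL
    rwa [Summit.QuantumFields.YangMills.Cruxes.NT.CeilingPrice.integral_abs_thetaTest] at this
  have hmain := far_sum_abs_smear_le_of_sep L hs hs1 (fun w => (thetaTest 4 v) w) (fun w => v w)
    (R₀ := R₀) (g := g) hg (fun w hw => (hθ' w hw).1) (fun w hw => (hv' w hw).1)
    (fun w hw => (hθ' w hw).2) (fun w hw => (hv' w hw).2) hL (torusK3 G r β L) hA n₀ hn1 hn2 hK hD2 hDR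
  have hSθ0 : 0 ≤ s ^ 4 * ∑ y ∈ box 4 L, |(thetaTest 4 v) (s • siteToE y)| := by positivity
  have hSv0 : 0 ≤ s ^ 4 * ∑ z ∈ box 4 L, |v (s • siteToE z)| := by positivity
  have hcoef0 : 0 ≤ 2 ^ 14 * A / (g ^ 4 * D) := by positivity
  rw [← Finset.sum_filter]
  calc ∑ x ∈ (box 4 L).filter (fun x : Site 4 => D < ‖s • siteToE x‖), |respM G r β L s v x|
      = ∑ x ∈ (box 4 L).filter (fun x : Site 4 => D < ‖s • siteToE x‖),
          |∑ y ∈ box 4 L, ∑ z ∈ box 4 L,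
            (thetaTest 4 v) (s • siteToE y) * v (s • siteToE z) * torusK3 G r β L x y z| := by
        simp only [respM]
    _ ≤ 2 ^ 14 * A / (g ^ 4 * D) * (s ^ 4 * ∑ y ∈ box 4 L, |(thetaTest 4 v) (s • siteToE y)|) *
          (s ^ 4 * ∑ z ∈ box 4 L, |v (s • siteToE z)|) := hmain
    _ ≤ 2 ^ 14 * A / (g ^ 4 * D) * N * N :=
        mul_le_mul (mul_le_mul_of_nonneg_left hSθ hcoef0) hSv hSv0 (by positivity)
    _ = 2 ^ 14 * A * N ^ 2 / (g ^ 4 * D) := by ring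
    _ ≤ η := by
        rw [div_le_iff₀ (by positivity)]
        have h1 : 2 ^ 14 * A * N ^ 2 < D * (g ^ 4 * η) := by rwa [div_lt_iff₀ (by positivity)] at hDA
        nlinarith

/-- **The re-cut `stub_far` from the SEPARATED far kernel hypothesis** (weaker physics input than in
`stub_far_of_farKernel`: the triangle majorant is required only for triples of pairwise torus distance `≥ n₀`, some `n₀`,
along the pinned unit — no claim at the lattice / contact scale).  Conclusion = the planner's registered `__Registered.stub_far`
text verbatim. -/
theorem stub_far_of_farKernelSep
    (hK : ∀ (G : Type) [Group G] [TopologicalSpace G] [IsTopologicalGroup G] [CompactSpace G],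
      IsCompactSimpleLieGroup G →
      letI : MeasurableSpace G := borel G
      haveI : BorelSpace G := ⟨rfl⟩
      ∀ (r : LatticeRep G) (a : ℝ → ℝ), (∀ β, 0 < a β) → Filter.Tendsto a Filter.atTop (nhds 0) →
        (∃ (v₀ : 𝓢(EuclideanSpace ℝ (Fin 4), ℝ)) (ε β₅ Λ₅ : ℝ), HasCompactSupport v₀ ∧
          tsupport v₀ ⊆ {y : EuclideanSpace ℝ (Fin 4) | 0 < y 0} ∧ 0 < ε ∧
          ∀ β : ℝ, β₅ ≤ β → ∀ L : ℕ, Λ₅ ≤ a β * L → ε ≤ Q2 G r β L (a β) (thetaTest 4 v₀) v₀) →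
        ∃ A β₀ Λ₀ : ℝ, ∃ n₀ : ℕ, 0 ≤ A ∧ ∀ β : ℝ, β₀ ≤ β → ∀ L : ℕ, Λ₀ ≤ a β * L →
          ∀ x ∈ box 4 L, ∀ y ∈ box 4 L, ∀ z ∈ box 4 L,
            (n₀ : ℝ) ≤ torusDist L x y → (n₀ : ℝ) ≤ torusDist L x z → (n₀ : ℝ) ≤ torusDist L y z →
            |torusK3 G r β L x y z| ≤
              A * (((1 + torusDist L x y) ^ 4)⁻¹ * ((1 + torusDist L x z) ^ 4)⁻¹ *
                ((1 + torusDist L y z) ^ 4)⁻¹)) :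
    ∀ (G : Type) [Group G] [TopologicalSpace G] [IsTopologicalGroup G] [CompactSpace G],
      IsCompactSimpleLieGroup G →
      letI : MeasurableSpace G := borel G
      haveI : BorelSpace G := ⟨rfl⟩
      ∀ (r : LatticeRep G) (a : ℝ → ℝ), (∀ β, 0 < a β) → Filter.Tendsto a Filter.atTop (nhds 0) →
        ∀ (p : EuclideanSpace ℝ (Fin 4)) (ρ ε : ℝ), 0 < ε → ∀ v : SchwartzMap (EuclideanSpace ℝ (Fin 4)) ℝ,
          tsupport v ⊆ Metric.closedBall p ρ → tsupport v ⊆ {y : EuclideanSpace ℝ (Fin 4) | 0 < y 0} →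
          (∫ y, |v y|) ≤ 1 →
          (∃ β₅ Λ₅ : ℝ, ∀ β : ℝ, β₅ ≤ β → ∀ L : ℕ, Λ₅ ≤ a β * L →
            ε ≤ Q2 G r β L (a β) (thetaTest 4 v) v) →
          ∀ η : ℝ, 0 < η → ∀ Λ : ℝ, 1 ≤ Λ → ∃ D : ℝ, 0 < D ∧ ∃ β₆ Λ₆ : ℝ, ∀ β : ℝ, β₆ ≤ β →
            ∀ L : ℕ, Λ₆ ≤ a β * L → ∀ l : ℝ, l ∈ Set.Icc 1 Λ →
              (∑ x ∈ box 4 L, (if D < ‖(l * a β) • siteToE x‖ then |respM G r β L (l * a β) v x| else 0)) ≤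
                η * (1 + |deriv (fun c : ℝ => Q2 G r c L (l * a β) (thetaTest 4 v) v) β|) := by
  intro G _ _ _ _ hG
  letI : MeasurableSpace G := borel G
  haveI : BorelSpace G := ⟨rfl⟩
  intro r a hpos hlim p ρ ε hε v hball hsupp _hL1 hfloor η hη Λ hΛ
  obtain ⟨β₅, Λ₅, hfl⟩ := hfloor
  have hcpt : HasCompactSupport (v : EuclideanSpace ℝ (Fin 4) → ℝ) :=
    (isCompact_closedBall p ρ).of_isClosed_subset (isClosed_tsupport _) hball
  obtain ⟨A, β₀, Λ₀, n₀, hA, hK3⟩ := hK G hG r a hpos hlim ⟨v, ε, β₅, Λ₅, hcpt, hsupp, hε, hfl⟩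
  obtain ⟨D, hD, s₀, hs₀, hfar⟩ := far_ceiling_of_gap_sep G r v hball hsupp hA n₀ hη
  have hΛ0 : 0 < Λ := by linarith
  have hev : ∀ᶠ β in Filter.atTop, a β < s₀ / Λ := hlim.eventually (gt_mem_nhds (by positivity))
  obtain ⟨β₁, hβ₁⟩ := Filter.eventually_atTop.mp hev
  refine ⟨D, hD, max β₀ β₁, max Λ₀ (2 * (‖p‖ + ρ)), fun β hβ L hL l hl => ?_⟩
  have hβ0 : β₀ ≤ β := le_trans (le_max_left _ _) hβ
  have hβ1 : β₁ ≤ β := le_trans (le_max_right _ _) hβ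
  have haβ : 0 < a β := hpos β
  have hs : 0 < l * a β := mul_pos (by linarith [hl.1]) haβ
  have hsle : l * a β ≤ s₀ := by
    have h1 : a β < s₀ / Λ := hβ₁ β hβ1
    have h2 : l * a β ≤ Λ * a β := mul_le_mul_of_nonneg_right hl.2 haβ.le
    have h3 : Λ * a β ≤ Λ * (s₀ / Λ) := mul_le_mul_of_nonneg_left h1.le hΛ0.le
    have h4 : Λ * (s₀ / Λ) = s₀ := by field_simp
    linarith
  have hLs : 2 * (‖p‖ + ρ) ≤ l * a β * L := by
    have h1 : 2 * (‖p‖ + ρ) ≤ a β * L := le_trans (le_max_right _ _) hL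
    have h2 : a β * L ≤ l * a β * L := by
      have : 0 ≤ a β * L := by positivity
      nlinarith [hl.1]
    linarith
  have hK3' := hK3 β hβ0 L (le_trans (le_max_left _ _) hL)
  have hmain := hfar (l * a β) hs hsle L hLs β hK3'
  calc (∑ x ∈ box 4 L, (if D < ‖(l * a β) • siteToE x‖ then |respM G r β L (l * a β) v x| else 0))
      ≤ η := hmain
    _ ≤ η * (1 + |deriv (fun c : ℝ => Q2 G r c L (l * a β) (thetaTest 4 v) v) β|) :=
        le_mul_of_one_le_right hη.le (by linarith [abs_nonneg (deriv (fun c : ℝ => Q2 G r c L (l * a β) (thetaTest 4 v) v) β)])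

end Separated

end Summit.QuantumFields.YangMills.Cruxes.ResponseLocalisation.Far

end
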